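import Summits.ResolutionOfSingularities.ResolutionOfSingularities.Theorems.EquisingularLiftEquisingularLiftNatTowerBDoublePrimeSAssembly
import Summits.ResolutionOfSingularities.ResolutionOfSingularities.Theorems.EquisingularLiftEquisingularLiftNatTowerBTriplePrimeRoundClosure
import Summits.ResolutionOfSingularities.ResolutionOfSingularities.Theorems.EquisingularLiftEquisingularLiftNatTowerBTriplePrimePointStepsFE
import Summits.ResolutionOfSingularities.ResolutionOfSingularities.Theorems.EquisingularLiftEquisingularLiftNatTowerReachSsDefs
import HarnessLib

/-!
# [OURS · L1 W4.5(b) · EL♮(3) · T23-A‴] HSUB⁗(ReachTowerB‴)₃ — THE TOWER ASSEMBLY V10⁗ (ABSTRACT INNER PHASE): `ReachTowerBTriplePrime` ⇒ the engine's conclusion,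
# for ANY inner (in-carrier) invariant with the (D‴5′) closure facts and a curve step landing in `Tower.InvB₄` — the interface res-type-027's (U6) bricks discharge (V10⁗-full)

res-L1-w45b-stub-4 g11 (T23-A‴ engine owner; engine word v1.2 FINAL `L/res-L1-w45b-stub-4/T23Atriple-ENGINE-WORD-v1.md` d02b1fbd6b6fb5d2, desk R28).
OURS; NOT a statement of any manuscript ([Hironaka2017] is a candidate under adjudication, nothing of it is asserted); AI-written, weaker than expert review.
No `sorry`; standard axioms; DEF-FREE; `--supports stmt-ResolutionOfSingularities-20148 --as helper`.

WHAT. Downstairs: res-L1-w45b-lead-2's `ReachTowerBTriplePrime F₁ F₂ υ x T₂ F' β T'` (…NatTowerReachSsDefs p628165: prefix, `InCarrierReachKSs` with the first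
plane `S`, the later in-carrier planes `Ps` and the model-less list `Ms` (seeds `υ⁻¹{x}`, `[]`, `[]`), the carrier round, a CHOSEN round seed `Es₁₀`/`Ns₁₀`, and the
round phase closed under `TowerPtRegB₄` / `TowerPtRamB₄` / `TowerRoundBTriplePrime`). Upstairs: the inner phase is ABSTRACT — an invariant
`INNER W G β T Z K S Ps Ms b` with NAMED INPUTS `hInnerInv` (projection to res-L1-w45b-stub-1's `TCPlus.Inv`), `hBase` (seed), `hStep` / `hSing` (the two
in-carrier point steps with the (D‴5′) list menus VERBATIM) and `hCurve` (the carrier round lands in `Tower.InvB₄ FE …` at the chosen seed, with the K-side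
facts) — exactly the interface res-type-027's (U6) plane-lineage bricks (`inv_baseSL`, `invSL_step_regular/_singular`, `Tower.invB₄_of_invSL_curveStep_FE`, and
the shadow-free twins) instantiate in V10⁗-full; the TOWER phase is CONCRETE: `INV₁‴ := (Tower.InvB₄ FE … ∧ K-side facts) ∧ hcar ∧ IsLocallyNoetherian F₉`
(hcar / Noetherianity read off `TCPlus.Inv` by `Tower.hcar_of_innerInv` / `Tower.isLocallyNoetherian_of_innerInv`, K-slot `∅`), closed under the three ‴ steps by
this seat's `Tower.towerPtRegB₄_invB₁_FE` / `Tower.towerPtRamB₄_invB₁_FE` (p627628) / `Tower.towerRoundBTriplePrime_invB₄_of_fact'` (p627682); final by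
`Tower.invB₄_final` (p624526). [cite: GortzWedhorn2020, (13.19) and Prop. 13.91] [cite: Liu2002, Thm. 8.1.19]
-/

set_option linter.dupNamespace false -- mandated namespace `Summit.<Summit>.<Problem>` of this single-conjunct summit
set_option linter.overlappingInstances false -- signatures carry `[IsDomain O] [IsDiscreteValuationRing O]`

noncomputable section

open CategoryTheory CategoryTheory.Limits AlgebraicGeometry TopologicalSpace Topology IsLocalRing
open Literature.AlgebraicGeometry.Resolution
open AlgebraicGeometry.Scheme.IdealSheafData
open Summit.ResolutionOfSingularities.ResolutionOfSingularities.Theses.EquisingularLift.Split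
open Summit.ResolutionOfSingularities.ResolutionOfSingularities.Cruxes.EquisingularLift.StrataSplit

namespace Summit.ResolutionOfSingularities.ResolutionOfSingularities.Cruxes.EquisingularLiftNat.Sections

/-- **HSUB⁗(ReachTowerB‴)₃, abstract inner phase** (module docstring). [OURS · L1 W4.5b · T23-A‴ engine] toward
`stub_elnat_defTowerBTriplePrimePointResolutionThree`; NOT a statement of the manuscript. -/
theorem hsub_reachTowerBTriplePrime_of_fact (k : Type) [Field k]
    (O : Type) [CommRing O] [IsDomain O] [IsDiscreteValuationRing O] [IsAdicComplete (IsLocalRing.maximalIdeal O) O]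
    [IsAlgClosed (IsLocalRing.ResidueField O)] (θ : O →+* k) (hθ : Function.Surjective θ)
    (P : Scheme.{0}) (q : P ⟶ Spec (.of O)) (Y : Set P) (Ch : ∀ X' : Scheme.{0}, (X' ⟶ P) → Set X' → Prop)
    (hChStep : ∀ (X' X'' : Scheme.{0}) (σ' : X' ⟶ P) (S' : Set X') (C : X'.IdealSheafData) (τ : X'' ⟶ X'),
      Ch X' σ' S' → IsBlowup τ C → Scheme.IsRegular C.subscheme → Flat (C.subschemeι ≫ σ' ≫ q) →
      σ' '' (C.support : Set X') ⊆ {y | ¬ IsGenericPoint y Y} → (C.support : Set X') ∩ (σ' ≫ q) ⁻¹' {IsLocalRing.closedPoint O} ⊆ S' →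
      Ch X'' (τ ≫ σ') (closure (τ ⁻¹' (S' \ (C.support : Set X')))))
    (hChSplit : ∀ (X' : Scheme.{0}) (σ' : X' ⟶ P) (S' : Set X'), Ch X' σ' S' → Chain P Y X' σ' S')
    (hYsp : Y ⊆ q ⁻¹' {IsLocalRing.closedPoint O}) (hYirr : IsIrreducible Y) (hYcl : IsClosed Y) (hPint : IsIntegral P)
    (hPnoeth : IsLocallyNoetherian P) (hPreg : Scheme.IsRegular P) (hqprop : IsProper q) (hqsm : SmoothOfRelativeDimension 3 q)
    {F₁ F₂ : Scheme.{0}} (υ : F₂ ⟶ F₁) (x : F₁) (T₁ : Set F₁)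
    -- (T-k) the embedded-curve lift at every stage / exceptional surface over `q` (res-L1-w45b-lead-2 …NatTowerRoundFourDefs p594791)
    (hFact : EmbeddedCurveLift O k θ P q)
    -- ===================== THE INNER PHASE, ABSTRACT: an invariant of the in-carrier chain with its (D‴5′) closure facts =====================
    (INNER : Set F₁ → ∀ G : Scheme.{0}, (G ⟶ F₂) → Set G → Set G → Set G → Set G → List (Set G) → List (Set G) → Bool → Prop)
    (hInnerInv : ∀ (W : Set F₁) (G : Scheme.{0}) (β : G ⟶ F₂) (T Z K S : Set G) (Ps Ms : List (Set G)) (b : Bool),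
      INNER W G β T Z K S Ps Ms b → TCPlus.Inv O k θ P q Y Ch W G β T Z b)
    (hBase : ∀ (W : Set F₁) (K₂ : Set F₂), x ∈ W → ¬ (υ ⁻¹' {x} ⊆ closure (υ ⁻¹' (W \ {x}))) →
        (∃ U₁ : F₁.affineOpens, x ∈ (U₁ : F₁.Opens) ∧
          ((vanishingIdeal (⟨closure W, isClosed_closure⟩ : Closeds F₁)).ideal U₁).IsPrincipal) →
        (K₂ = ∅ ∨ (ConeForm F₁ x W ∧ K₂ = closure (υ ⁻¹' (W \ {x})))) →
        INNER W F₂ (𝟙 F₂) (closure (υ ⁻¹' (T₁ \ {x}))) (υ ⁻¹' {x} ∩ closure (υ ⁻¹' (W \ {x}))) K₂ (υ ⁻¹' {x}) [] [] false)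
    (hStep : ∀ (W : Set F₁) (G₁ G₂ : Scheme.{0}) (β : G₁ ⟶ F₂) (T Z K S : Set G₁) (Ps Ms : List (Set G₁)) (b : Bool)
        (y : ↥((vanishingIdeal (⟨closure Z, isClosed_closure⟩ : Closeds G₁))).subscheme) (υ₁ : G₂ ⟶ G₁) (hy : IsClosed ({(((vanishingIdeal (⟨closure Z, isClosed_closure⟩ : Closeds G₁))).subschemeι y : G₁)} : Set G₁)) (Ps' Ms' : List (Set G₂)),
        INNER W G₁ β T Z K S Ps Ms b → (((vanishingIdeal (⟨closure Z, isClosed_closure⟩ : Closeds G₁))).subschemeι y : G₁) ∈ T →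
        IsRegularLocalRing (((vanishingIdeal (⟨closure Z, isClosed_closure⟩ : Closeds G₁))).subscheme.presheaf.stalk y) →
        IsRegularLocalRing (G₁.presheaf.stalk (((vanishingIdeal (⟨closure Z, isClosed_closure⟩ : Closeds G₁))).subschemeι y : G₁)) →
        IsBlowup υ₁ (vanishingIdeal (⟨{(((vanishingIdeal (⟨closure Z, isClosed_closure⟩ : Closeds G₁))).subschemeι y : G₁)}, hy⟩ : Closeds G₁)) →
        (∀ P' ∈ Ps', P' = υ₁ ⁻¹' {(((vanishingIdeal (⟨closure Z, isClosed_closure⟩ : Closeds G₁))).subschemeι y : G₁)} ∨ ∃ P₀ ∈ Ps, (((vanishingIdeal (⟨closure Z, isClosed_closure⟩ : Closeds G₁))).subschemeι y : G₁) ∉ P₀ ∧ P' = closure (υ₁ ⁻¹' (P₀ \ {(((vanishingIdeal (⟨closure Z, isClosed_closure⟩ : Closeds G₁))).subschemeι y : G₁)}))) →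
        (∀ M' ∈ Ms', ∃ F ∈ Ps ++ Ms, M' = closure (υ₁ ⁻¹' (F \ {(((vanishingIdeal (⟨closure Z, isClosed_closure⟩ : Closeds G₁))).subschemeι y : G₁)}))) →
        INNER W G₂ (υ₁ ≫ β) (closure (υ₁ ⁻¹' (T \ {(((vanishingIdeal (⟨closure Z, isClosed_closure⟩ : Closeds G₁))).subschemeι y : G₁)}))) (closure (υ₁ ⁻¹' (Z \ {(((vanishingIdeal (⟨closure Z, isClosed_closure⟩ : Closeds G₁))).subschemeι y : G₁)}))) (closure (υ₁ ⁻¹' (K \ {(((vanishingIdeal (⟨closure Z, isClosed_closure⟩ : Closeds G₁))).subschemeι y : G₁)})))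
          (closure (υ₁ ⁻¹' (S \ {(((vanishingIdeal (⟨closure Z, isClosed_closure⟩ : Closeds G₁))).subschemeι y : G₁)}))) Ps' Ms' b)
    (hSing : ∀ (W : Set F₁) (G₁ G₂ : Scheme.{0}) (β : G₁ ⟶ F₂) (T Z K S : Set G₁) (Ps Ms : List (Set G₁))
        (y : ↥((vanishingIdeal (⟨closure Z, isClosed_closure⟩ : Closeds G₁))).subscheme) (υ₁ : G₂ ⟶ G₁) (hy : IsClosed ({(((vanishingIdeal (⟨closure Z, isClosed_closure⟩ : Closeds G₁))).subschemeι y : G₁)} : Set G₁)) (Ps' Ms' : List (Set G₂)),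
        INNER W G₁ β T Z K S Ps Ms false → (((vanishingIdeal (⟨closure Z, isClosed_closure⟩ : Closeds G₁))).subschemeι y : G₁) ∈ T →
        ¬ IsRegularLocalRing (((vanishingIdeal (⟨closure Z, isClosed_closure⟩ : Closeds G₁))).subscheme.presheaf.stalk y) →
        IsRegularLocalRing (G₁.presheaf.stalk (((vanishingIdeal (⟨closure Z, isClosed_closure⟩ : Closeds G₁))).subschemeι y : G₁)) →
        IsBlowup υ₁ (vanishingIdeal (⟨{(((vanishingIdeal (⟨closure Z, isClosed_closure⟩ : Closeds G₁))).subschemeι y : G₁)}, hy⟩ : Closeds G₁)) →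
        (∀ P' ∈ Ps', P' = υ₁ ⁻¹' {(((vanishingIdeal (⟨closure Z, isClosed_closure⟩ : Closeds G₁))).subschemeι y : G₁)} ∨ ∃ P₀ ∈ Ps, (((vanishingIdeal (⟨closure Z, isClosed_closure⟩ : Closeds G₁))).subschemeι y : G₁) ∉ P₀ ∧ P' = closure (υ₁ ⁻¹' (P₀ \ {(((vanishingIdeal (⟨closure Z, isClosed_closure⟩ : Closeds G₁))).subschemeι y : G₁)}))) →
        (∀ M' ∈ Ms', ∃ F ∈ Ps ++ Ms, M' = closure (υ₁ ⁻¹' (F \ {(((vanishingIdeal (⟨closure Z, isClosed_closure⟩ : Closeds G₁))).subschemeι y : G₁)}))) →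
        INNER W G₂ (υ₁ ≫ β) (closure (υ₁ ⁻¹' (T \ {(((vanishingIdeal (⟨closure Z, isClosed_closure⟩ : Closeds G₁))).subschemeι y : G₁)}))) (closure (υ₁ ⁻¹' (Z \ {(((vanishingIdeal (⟨closure Z, isClosed_closure⟩ : Closeds G₁))).subschemeι y : G₁)}))) (closure (υ₁ ⁻¹' (K \ {(((vanishingIdeal (⟨closure Z, isClosed_closure⟩ : Closeds G₁))).subschemeι y : G₁)})))
          (closure (υ₁ ⁻¹' (S \ {(((vanishingIdeal (⟨closure Z, isClosed_closure⟩ : Closeds G₁))).subschemeι y : G₁)}))) Ps' Ms' true)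
    -- (curve) the carrier round lands in `Tower.InvB₄ FE` at the CHOSEN round seed, with the K-side facts
    (hCurve : ∀ (W : Set F₁) (F₉ : Scheme.{0}) (β₉ : F₉ ⟶ F₂) (T₉ Z₉ K₉ S₉ : Set F₉) (Ps₉ Ms₉ : List (Set F₉)) (b₉ : Bool) (hZ₉ : IsClosed Z₉)
        (F₁₀ : Scheme.{0}) (υ' : F₁₀ ⟶ F₉) (Es₁₀ Ns₁₀ : List (Set F₁₀)),
        INNER W F₉ β₉ T₉ Z₉ K₉ S₉ Ps₉ Ms₉ b₉ → Z₉ ⊆ T₉ → ¬ (T₉ ⊆ Z₉) → Z₉.Infinite →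
        IsBlowup υ' (vanishingIdeal (⟨Z₉, hZ₉⟩ : Closeds F₉)) →
        (∀ F ∈ Es₁₀, F = closure (υ' ⁻¹' (S₉ \ Z₉)) ∨
          ∃ P₀ ∈ Ps₉, ∃ hP : IsClosed P₀,
            (∀ g ∈ Z₉ ∩ P₀, stalkIdeal (vanishingIdeal (⟨Z₉, hZ₉⟩ : Closeds F₉)) g ⊔ stalkIdeal (vanishingIdeal (⟨P₀, hP⟩ : Closeds F₉)) g =
                maximalIdeal (F₉.presheaf.stalk g)) ∧
            (∀ g ∈ Z₉ ∩ P₀, stalkIdeal (vanishingIdeal (⟨Z₉, hZ₉⟩ : Closeds F₉)) g ≠ maximalIdeal (F₉.presheaf.stalk g)) ∧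
            F = closure (υ' ⁻¹' (P₀ \ Z₉))) →
        (∀ F ∈ Ns₁₀, ∃ P₀ ∈ Ps₉ ++ Ms₉, F = closure (υ' ⁻¹' (P₀ \ Z₉))) →
        Tower.InvB₄ O k θ P q Y Ch (fun _ _ _ _ _ _ _ _ _ σ _ 𝓔 => Flat (𝓔.subschemeι ≫ σ ≫ q)) F₉ Z₉ hZ₉ F₁₀ υ' F₁₀ (𝟙 F₁₀)
            (closure (υ' ⁻¹' (T₉ \ Z₉))) (υ' ⁻¹' Z₉) Es₁₀ Ns₁₀ (closure (υ' ⁻¹' (K₉ \ Z₉))) ∧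
          IsClosed (closure (υ' ⁻¹' (K₉ \ Z₉))) ∧
          closure (υ' ⁻¹' (K₉ \ Z₉)) ⊆ closure (closure (υ' ⁻¹' (K₉ \ Z₉)) \ υ' ⁻¹' Z₉) ∧ closure (υ' ⁻¹' (K₉ \ Z₉)) ≠ Set.univ) :
    -- ===================== THE CONCLUSION OF HSUB⁗(ReachTowerB‴)₃ =====================
    ∀ (F' : Scheme.{0}) (β : F' ⟶ F₂) (T' : Set F'), ReachTowerBTriplePrime F₁ F₂ υ x (closure (υ ⁻¹' (T₁ \ {x}))) F' β T' →
      ∃ (X₉ : Scheme.{0}) (σ₉ : X₉ ⟶ P) (S₉ : Set X₉) (j₉ : F' ⟶ X₉) (t₉ : F' ⟶ Spec (.of k)),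
        Ch X₉ σ₉ S₉ ∧ IsIntegral X₉ ∧ IsLocallyNoetherian X₉ ∧ Scheme.IsRegular X₉ ∧ IsDominant (σ₉ ≫ q) ∧
        IsPullback j₉ t₉ (σ₉ ≫ q) (Spec.map (CommRingCat.ofHom θ)) ∧ j₉ '' T' = S₉ ∧ IsClosed T' ∧ IsIrreducible T' ∧ IsIntegral F' := by
  intro F' β T' hReach
  classical
  haveI := hPint; haveI := hqprop; haveI := hqsm
  obtain ⟨W, K₂, F₉, β₉, T₉, Z₉, K₉, S₉, Ps₉, Ms₉, b₉, hZ₉, F₁₀, υ', Es₁₀, Ns₁₀, γ', E', Es', Ns', K', hxW, hnot, hWpr, -, hK₂, hinner, hZ₉T₉,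
    hT₉Z₉, hZinf, -, hυ', hEs₁₀, hNs₁₀, hcl, -⟩ := hReach
  let FE : Tower.RuledDatum P := fun _ _ _ _ _ _ _ _ _ σ _ 𝓔 => Flat (𝓔.subschemeι ≫ σ ≫ q)
  -- ===================== the inner closure: `INNER W` at the carrier =====================
  have h₉ : INNER W F₉ β₉ T₉ Z₉ K₉ S₉ Ps₉ Ms₉ b₉ := hinner (INNER W) (hBase W K₂ hxW hnot hWpr hK₂)
    (fun G₁ G₂ β T Z K S Ps Ms b y υ₁ hy Ps' Ms' hI hyT h1 h2 hbl hPs hMs => hStep W G₁ G₂ β T Z K S Ps Ms b y υ₁ hy Ps' Ms' hI hyT h1 h2 hbl hPs hMs)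
    (fun G₁ G₂ β T Z K S Ps Ms y υ₁ hy Ps' Ms' hI hyT h1 h2 hbl hPs hMs => hSing W G₁ G₂ β T Z K S Ps Ms y υ₁ hy Ps' Ms' hI hyT h1 h2 hbl hPs hMs)
  -- the carrier datum / Noetherianity read off `TCPlus.Inv` (V7's `hcarOf`, K-slot `∅`)
  have hInv₉ := hInnerInv W F₉ β₉ T₉ Z₉ K₉ S₉ Ps₉ Ms₉ b₉ h₉
  have hcar := Tower.hcar_of_innerInv O k θ hθ P q Y hYirr hYcl Ch hChSplit (F₁ := F₁) (F₂ := F₂) W β₉ T₉ Z₉ ∅ b₉ hZ₉ (Or.inl ⟨rfl, hInv₉⟩)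
  have hF₉noeth := Tower.isLocallyNoetherian_of_innerInv O k θ hθ P q Y Ch (F₁ := F₁) (F₂ := F₂) W β₉ T₉ Z₉ ∅ b₉ (Or.inl ⟨rfl, hInv₉⟩)
  haveI := hF₉noeth
  -- ===================== (curve): the tower invariant `INV₁‴` at the chosen SEED =====================
  let INV₁ : ∀ (F₉ : Scheme.{0}) (Z₉ : Set F₉), IsClosed Z₉ → ∀ (F₁₀ : Scheme.{0}), (F₁₀ ⟶ F₉) →
      ∀ G : Scheme.{0}, (G ⟶ F₁₀) → Set G → Set G → List (Set G) → List (Set G) → Set G → Prop :=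
    fun F₉ Z₉ hZ₉ F₁₀ υ' G γ T E Es Ns K => (Tower.InvB₄ O k θ P q Y Ch FE F₉ Z₉ hZ₉ F₁₀ υ' G γ T E Es Ns K ∧
      IsClosed K ∧ K ⊆ closure (K \ E) ∧ K ≠ Set.univ) ∧
      (∀ z : ↥(redSub F₉ Z₉ hZ₉), IsClosed ({z} : Set ↥(redSub F₉ Z₉ hZ₉)) →
        ringKrullDim ((redSub F₉ Z₉ hZ₉).presheaf.stalk z) = ((1 : ℕ) : WithBot ℕ∞)) ∧ IsLocallyNoetherian F₉
  have hseed : INV₁ F₉ Z₉ hZ₉ F₁₀ υ' F₁₀ (𝟙 F₁₀) (closure (υ' ⁻¹' (T₉ \ Z₉))) (υ' ⁻¹' Z₉) Es₁₀ Ns₁₀ (closure (υ' ⁻¹' (K₉ \ Z₉))) :=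
    ⟨hCurve W F₉ β₉ T₉ Z₉ K₉ S₉ Ps₉ Ms₉ b₉ hZ₉ F₁₀ υ' Es₁₀ Ns₁₀ h₉ hZ₉T₉ hT₉Z₉ hZinf hυ' hEs₁₀ hNs₁₀, hcar, hF₉noeth⟩
  -- ===================== the tower closure (pt-reg / pt-ram / round = this seat's ‴ closures) and (final) =====================
  have h' : INV₁ F₉ Z₉ hZ₉ F₁₀ υ' F' γ' T' E' Es' Ns' K' :=
    hcl (INV₁ F₉ Z₉ hZ₉ F₁₀ υ') hseed
      (Tower.towerPtRegB₄_invB₁_FE O k θ hθ P q Y hYsp hYirr hYcl hPnoeth hPreg Ch hChStep hChSplit F₉ Z₉ hZ₉ F₁₀ υ')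
      (Tower.towerPtRamB₄_invB₁_FE O k θ hθ P q Y hYsp hYirr hYcl hPnoeth hPreg Ch hChStep hChSplit F₉ Z₉ hZ₉ F₁₀ υ')
      (Tower.towerRoundBTriplePrime_invB₄_of_fact' O k θ hθ P q Y hYsp hYirr hYcl hPnoeth hPreg Ch hChStep hChSplit hFact Z₉ hZ₉ υ')
  exact Tower.invB₄_final O k θ P q Y Ch FE F₉ Z₉ hZ₉ F₁₀ υ' F' γ' T' E' Es' Ns' K' h'.1.1

end Summit.ResolutionOfSingularities.ResolutionOfSingularities.Cruxes.EquisingularLiftNat.Sections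

end
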